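import Summits.KontsevichZagierPeriods.KontsevichZagierPeriods.Theses.Grothendieck
import Literature.NumberTheory.Transcendental.KZRulesAssociator
import Mathlib.Algebra.FreeAbelianGroup.Finsupp

/-!
# Birth skeleton — piece CAN `NonzeroPeriodCancellation` of the split of `Grothendieck.SectorComplement`

`NonzeroPeriodCancellation := ∀ u x : P, evalP u ≠ 0 → u * x = 0 → x = 0` (`P = KZ.FormalPeriodRing`).

LINE "sign first, then divide by a positive integral": a formal combination `c_u` of non-zero
value is, up to sign, of POSITIVE value, hence (ARCH — every class of positive value is
move-equivalent to a sum of representations with non-negative integrands: the provable packing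
layer of route InequalityCost, Viu-Sos arXiv:1509.01097 §4) congruent to a positive-cone element
`q`; so `u · x = 0` becomes `⟦q⟧ · x = 0` with `q` a SUM OF NON-NEGATIVE REPRESENTATIONS of
positive total value, and the geometric heart is isolated as cancellation of such a factor
(`stub_posConeCancellation`: dividing by a positive dummy integral — the `[disc, 1] = π` instance is
AyoubSpecialisation 0540 up to ARCH).

* `stub_archCertificates` (M/L, InequalityCost's layer; stated exactly as `ArchCertificates` of
  the crux workfile `StrategistP1.lean`);
* `stub_posConeCancellation` (L/open: cancellation of a positive-cone factor of positive value);
* composition `NonzeroPeriodCancellation_of` PROVED (lift to `FormalRep`, fix the sign, swap the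
  factor modulo relations, cancel).
-/

noncomputable section

set_option linter.dupNamespace false

namespace Summit.KontsevichZagierPeriods.KontsevichZagierPeriods.Cruxes.SectorComplement.StrategistR1.CanBirth

open Literature.NumberTheory.Transcendental KZ

/-- CAN (the piece; route decl `Grothendieck.NonzeroPeriodCancellation` after the split). -/
def NonzeroPeriodCancellation : Prop :=
  ∀ u x : FormalPeriodRing, evalP u ≠ 0 → u * x = 0 → x = 0

/-- The positive cone `C = ℕ[non-negative representations] ⊆ FormalRep` (as in the landed
`Theorems/ReducedPeriodRing/Negative/PositiveCone.lean` and `StrategistP1.posCone`). -/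
abbrev posCone : AddSubmonoid FormalRep :=
  AddSubmonoid.closure (FreeAbelianGroup.of ''
    {x : Σ n, IntegralRep n | ∀ y ∈ x.2.domain, 0 ≤ x.2.integrand y})

/-- **stub ARCH — inequality certificates** (verbatim `StrategistP1.ArchCertificates`): every
formal combination of strictly positive value is move-equivalent to a positive-cone element. -/
theorem stub_archCertificates :
    ∀ c : FormalRep, 0 < eval c → ∃ q ∈ posCone, c - q ∈ relations := by
  sorry

/-- **stub — cancellation of a POSITIVE-CONE factor**: if `q` is a sum of representations with
non-negative integrands and positive total value, `q · c ∈ relations` forces `c ∈ relations`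
("divide by a positive dummy integral"). -/
theorem stub_posConeCancellation :
    ∀ q ∈ posCone, 0 < eval q → ∀ c : FormalRep, q * c ∈ relations → c ∈ relations := by
  sorry

/-- A factor may be swapped modulo relations: `c ≡ c'` gives `c · d ≡ c' · d` (relations are an
ideal for the Fubini product — read in `P`). [folklore] -/
theorem mul_mem_relations_of_sub_mem {c c' d : FormalRep} (h : c - c' ∈ relations)
    (hcd : c * d ∈ relations) : c' * d ∈ relations := by
  rw [← toFormalPeriod_eq_zero_iff] at hcd ⊢
  have hc : toFormalPeriod c = toFormalPeriod c' := toFormalPeriod_eq_iff.mpr h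
  rw [map_mul] at hcd ⊢
  rwa [hc] at hcd

/-- **Composition**: ARCH and positive-cone cancellation give CAN. Lift `u = ⟦c_u⟧`, `x = ⟦c_x⟧`;
replace `c_u` by `−c_u` if its value is negative; ARCH gives `q ∈ C` with `c_u ≡ q`, so
`q · c_x ≡ c_u · c_x ∈ relations`; cancel `q`. -/
theorem NonzeroPeriodCancellation_of
    (hA : ∀ c : FormalRep, 0 < eval c → ∃ q ∈ posCone, c - q ∈ relations)
    (hP : ∀ q ∈ posCone, 0 < eval q → ∀ c : FormalRep, q * c ∈ relations → c ∈ relations) :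
    NonzeroPeriodCancellation := by
  intro u x hu hux
  obtain ⟨cu, rfl⟩ := toFormalPeriod_surjective u
  obtain ⟨cx, rfl⟩ := toFormalPeriod_surjective x
  rw [evalP_toFormalPeriod] at hu
  -- `c_u · c_x ∈ relations`, and also `(−c_u) · c_x ∈ relations`
  have hmem : cu * cx ∈ relations := by
    rw [← toFormalPeriod_eq_zero_iff, map_mul]; exact hux
  have hmem' : (-cu) * cx ∈ relations := by
    rw [neg_mul]; exact relations.neg_mem hmem
  -- fix the sign: a combination `c` of POSITIVE value with `c · c_x ∈ relations`
  obtain ⟨c, hcpos, hc⟩ : ∃ c : FormalRep, 0 < eval c ∧ c * cx ∈ relations := by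
    rcases lt_or_gt_of_ne hu with hneg | hpos
    · exact ⟨-cu, by rw [map_neg]; exact neg_pos.mpr hneg, hmem'⟩
    · exact ⟨cu, hpos, hmem⟩
  -- ARCH: `c ≡ q` with `q` in the positive cone (and of the same, positive, value)
  obtain ⟨q, hq, hcq⟩ := hA c hcpos
  have hqval : 0 < eval q := by
    have h0 : eval (c - q) = 0 := relations_le_ker_eval_holds hcq
    rw [map_sub, sub_eq_zero] at h0
    rwa [← h0]
  -- swap the factor and cancel
  have hqc : q * cx ∈ relations := mul_mem_relations_of_sub_mem hcq hc
  exact toFormalPeriod_eq_zero_iff.mpr (hP q hq hqval cx hqc)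

/-- The composition instantiated with the stubs. -/
theorem NonzeroPeriodCancellation_of_stubs : NonzeroPeriodCancellation :=
  NonzeroPeriodCancellation_of stub_archCertificates stub_posConeCancellation

end Summit.KontsevichZagierPeriods.KontsevichZagierPeriods.Cruxes.SectorComplement.StrategistR1.CanBirth
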